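import Mathlib
import HarnessLib

/-!
# Route `UnitScaleTilt`, crux K1 child «MinimiserStabilityRegPr» (stmt-QuantumFields-19200), line «route-R», stub S — THE ORDERED SECOND-ORDER EXPANSION OF A
# PRODUCT `Π(1 + A_i)`: remainder `≤ e^s − 1 − s − s²/2` (`s = Σ‖A_i‖`) and the PAIR SUM AS HALF A SQUARE PLUS HALF THE COMMUTATOR SUM

Cell `ym3-torus` ∕ fleet seat `ym-ust-19200-p1` (gen 10; HUMAN RULING D-0037, YM ladder rung R3).  WHY.  Stub S of route-R (`RouteR.stub_firstVariationOpt`) reduces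
(w1-19200's chain `Prop7FirstVariation*`, `Prop7FibreVelocity*`) to a constraint-velocity bound whose k-uniform form needs the STRUCTURE of the second variation of the
k-fold (0.4)-average along an exponential family: per contour `Γ` the holonomy ratio is an ORDERED product `Π_i(1 + A_i)` of transported bond fluctuations, and its
second-order part `Σ_{i<j}A_iA_j` splits as `½(Σ_iA_i)² − ½Σ_iA_i² + ½Σ_{i<j}[A_i, A_j]` — for `𝔰𝔲(2)`-valued first-order parts the squares are SCALAR and are removed by
the unitarisation of the average, so only the COMMUTATOR PAIR SUM survives (route-R card §2(b): its coefficients, after the mean over contours and the pairing with the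
multipliers, are the current `J_b′` of the downstream bond).  This file supplies the generic algebra∕analysis, for any normed ring with `‖1‖ = 1` and any finite ordered
family `A : Fin m → R`: the three Taylor bounds of the ordered product (`‖Π(1+A_i) − 1‖ ≤ e^s − 1`, `‖Π(1+A_i) − 1 − ΣA_i‖ ≤ e^s − 1 − s`,
`‖Π(1+A_i) − 1 − ΣA_i − Σ_{i<j}A_iA_j‖ ≤ e^s − 1 − s − s²/2`, `s = Σ‖A_i‖`, by induction with `1 + b ≤ e^b`, `1 + b + b²/2 ≤ e^b`) and the identity
`2·Σ_{i<j}A_iA_j = (ΣA_i)² − ΣA_i² + Σ_{i<j}(A_iA_j − A_jA_i)`.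

WHAT IS PROVED (sorry-free, no definition).  `pairSum_succ`, `commSum_succ` (the `Fin.succ` recursions), **`norm_orderedProd_sub_one_le`**,
**`norm_orderedProd_sub_one_sub_sum_le`**, **`norm_orderedProd_taylor2_le`**, **`two_smul_pairSum_eq`** (`e^s − 1 − s − s²/2 ≤ (s³/6)e^s` gives the cubic form of the remainder).

HONEST SCOPE.  Elementary; no lattice object appears; count-neutral helper toward stmt-QuantumFields-19200 (`--supports`), to be instantiated on the (0.4) contours by the
S-supplier.  Not a claim about the continuum limit or the mass gap.

References: T. Bałaban, CMP 98 (1985) 17–51 [Balaban1985Averaging] ((19)–(23) p.21, the expansion of the averaged holonomies); CMP 102 (1985) 277–309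
[Balaban1985Variational] ((141)–(143) p.299).
-/

noncomputable section

open scoped BigOperators

namespace Summit.QuantumFields.YangMills.Theorems.Prop7OrderedProductExpansion

open Finset Real

variable {R : Type*} [NormedRing R] [NormOneClass R]

/-! ## §1 The `Fin.succ` recursions (ordered product, pair sum, square sum, commutator sum) -/

omit [NormOneClass R] in
/-- The ordered pair sum peels: `Σ_{i<j} A_iA_j = A_0·Σ_i A_{i+1} + Σ_{i<j} A_{i+1}A_{j+1}`. [folklore] -/
theorem pairSum_succ {m : ℕ} (A : Fin (m + 1) → R) :
    (∑ i : Fin (m + 1), ∑ j : Fin (m + 1), if i < j then A i * A j else 0)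
      = A 0 * ∑ i : Fin m, A i.succ + ∑ i : Fin m, ∑ j : Fin m, if i < j then A i.succ * A j.succ else 0 := by
  rw [Fin.sum_univ_succ]
  congr 1
  · rw [Fin.sum_univ_succ, if_neg (lt_irrefl _), zero_add, Finset.mul_sum]
    refine Finset.sum_congr rfl fun j _ => ?_
    rw [if_pos (Fin.succ_pos j)]
  · refine Finset.sum_congr rfl fun i _ => ?_
    rw [Fin.sum_univ_succ, if_neg (Fin.not_lt_zero _), zero_add]
    refine Finset.sum_congr rfl fun j _ => ?_
    simp only [Fin.succ_lt_succ_iff]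

omit [NormOneClass R] in
/-- The ordered commutator sum peels: `Σ_{i<j}(A_iA_j − A_jA_i) = (A_0·T − T·A_0) + Σ_{i<j}(A_{i+1}A_{j+1} − A_{j+1}A_{i+1})`, `T = Σ_i A_{i+1}`. [folklore] -/
theorem commSum_succ {m : ℕ} (A : Fin (m + 1) → R) :
    (∑ i : Fin (m + 1), ∑ j : Fin (m + 1), if i < j then A i * A j - A j * A i else 0)
      = (A 0 * ∑ i : Fin m, A i.succ - (∑ i : Fin m, A i.succ) * A 0)
        + ∑ i : Fin m, ∑ j : Fin m, if i < j then A i.succ * A j.succ - A j.succ * A i.succ else 0 := by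
  rw [Fin.sum_univ_succ]
  congr 1
  · rw [Fin.sum_univ_succ, if_neg (lt_irrefl _), zero_add, Finset.mul_sum, Finset.sum_mul, ← Finset.sum_sub_distrib]
    refine Finset.sum_congr rfl fun j _ => ?_
    rw [if_pos (Fin.succ_pos j)]
  · refine Finset.sum_congr rfl fun i _ => ?_
    rw [Fin.sum_univ_succ, if_neg (Fin.not_lt_zero _), zero_add]
    refine Finset.sum_congr rfl fun j _ => ?_
    simp only [Fin.succ_lt_succ_iff]

/-! ## §2 The three Taylor bounds of the ordered product -/

/-- `‖Π(1 + A_i)‖ ≤ e^{Σ‖A_i‖}` and **`‖Π(1 + A_i) − 1‖ ≤ e^{Σ‖A_i‖} − 1`**. [folklore] -/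
theorem norm_orderedProd_sub_one_le : ∀ {m : ℕ} (A : Fin m → R),
    ‖(List.ofFn fun i => (1 : R) + A i).prod - 1‖ ≤ Real.exp (∑ i, ‖A i‖) - 1 := by
  intro m
  induction m with
  | zero => intro A; simp
  | succ m ih =>
    intro A
    rw [List.ofFn_succ, List.prod_cons, Fin.sum_univ_succ]
    set Q := (List.ofFn fun i : Fin m => (1 : R) + A i.succ).prod with hQ
    set t := ∑ i : Fin m, ‖A i.succ‖ with ht
    have hIH : ‖Q - 1‖ ≤ Real.exp t - 1 := ih _
    have hQn : ‖Q‖ ≤ Real.exp t := by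
      have : ‖Q‖ ≤ ‖Q - 1‖ + ‖(1 : R)‖ := by
        calc ‖Q‖ = ‖(Q - 1) + 1‖ := by rw [sub_add_cancel]
          _ ≤ ‖Q - 1‖ + ‖(1 : R)‖ := norm_add_le _ _
      rw [norm_one] at this; linarith
    have e : (1 + A 0) * Q - 1 = (Q - 1) + A 0 * Q := by noncomm_ring
    rw [e]
    have hb : 0 ≤ ‖A 0‖ := norm_nonneg _
    have hexp := Real.add_one_le_exp ‖A 0‖
    calc ‖(Q - 1) + A 0 * Q‖ ≤ ‖Q - 1‖ + ‖A 0‖ * ‖Q‖ := (norm_add_le _ _).trans (add_le_add le_rfl (norm_mul_le _ _))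
      _ ≤ (Real.exp t - 1) + ‖A 0‖ * Real.exp t := add_le_add hIH (mul_le_mul_of_nonneg_left hQn hb)
      _ = (1 + ‖A 0‖) * Real.exp t - 1 := by ring
      _ ≤ Real.exp (‖A 0‖) * Real.exp t - 1 := by
          have := mul_le_mul_of_nonneg_right (by linarith [hexp] : 1 + ‖A 0‖ ≤ Real.exp ‖A 0‖) (Real.exp_pos t).le
          linarith
      _ = Real.exp (‖A 0‖ + t) - 1 := by rw [Real.exp_add]

/-- **`‖Π(1 + A_i) − 1 − ΣA_i‖ ≤ e^s − 1 − s`**, `s = Σ‖A_i‖`. [folklore] -/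
theorem norm_orderedProd_sub_one_sub_sum_le : ∀ {m : ℕ} (A : Fin m → R),
    ‖(List.ofFn fun i => (1 : R) + A i).prod - 1 - ∑ i, A i‖ ≤ Real.exp (∑ i, ‖A i‖) - 1 - ∑ i, ‖A i‖ := by
  intro m
  induction m with
  | zero => intro A; simp
  | succ m ih =>
    intro A
    rw [List.ofFn_succ, List.prod_cons, Fin.sum_univ_succ, Fin.sum_univ_succ (f := fun i => ‖A i‖)]
    set Q := (List.ofFn fun i : Fin m => (1 : R) + A i.succ).prod with hQ
    set T := ∑ i : Fin m, A i.succ with hT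
    set t := ∑ i : Fin m, ‖A i.succ‖ with ht
    have h1 : ‖Q - 1‖ ≤ Real.exp t - 1 := norm_orderedProd_sub_one_le _
    have h2 : ‖Q - 1 - T‖ ≤ Real.exp t - 1 - t := ih _
    have e : (1 + A 0) * Q - 1 - (A 0 + T) = (Q - 1 - T) + A 0 * (Q - 1) := by noncomm_ring
    rw [e]
    have hb : 0 ≤ ‖A 0‖ := norm_nonneg _
    have hq := Real.add_one_le_exp ‖A 0‖
    have ht0 : 0 ≤ Real.exp t := (Real.exp_pos t).le
    calc ‖(Q - 1 - T) + A 0 * (Q - 1)‖ ≤ ‖Q - 1 - T‖ + ‖A 0‖ * ‖Q - 1‖ := (norm_add_le _ _).trans (add_le_add le_rfl (norm_mul_le _ _))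
      _ ≤ (Real.exp t - 1 - t) + ‖A 0‖ * (Real.exp t - 1) := add_le_add h2 (mul_le_mul_of_nonneg_left h1 hb)
      _ ≤ Real.exp (‖A 0‖ + t) - 1 - (‖A 0‖ + t) := by
          rw [Real.exp_add]
          nlinarith [hq, ht0, mul_le_mul_of_nonneg_right hq ht0]

/-- **THE ORDERED SECOND-ORDER EXPANSION**: `‖Π(1 + A_i) − 1 − ΣA_i − Σ_{i<j}A_iA_j‖ ≤ e^s − 1 − s − s²/2`, `s = Σ‖A_i‖`. [cite: Balaban1985Averaging, (19)-(23) p.21] -/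
theorem norm_orderedProd_taylor2_le : ∀ {m : ℕ} (A : Fin m → R),
    ‖(List.ofFn fun i => (1 : R) + A i).prod - 1 - ∑ i, A i - ∑ i, ∑ j, (if i < j then A i * A j else 0)‖
      ≤ Real.exp (∑ i, ‖A i‖) - 1 - ∑ i, ‖A i‖ - (∑ i, ‖A i‖) ^ 2 / 2 := by
  intro m
  induction m with
  | zero => intro A; simp
  | succ m ih =>
    intro A
    rw [List.ofFn_succ, List.prod_cons, pairSum_succ, Fin.sum_univ_succ (f := fun i => A i), Fin.sum_univ_succ (f := fun i => ‖A i‖)]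
    set Q := (List.ofFn fun i : Fin m => (1 : R) + A i.succ).prod with hQ
    set T := ∑ i : Fin m, A i.succ with hT
    set S₂ := ∑ i : Fin m, ∑ j : Fin m, (if i < j then A i.succ * A j.succ else 0) with hS₂
    set t := ∑ i : Fin m, ‖A i.succ‖ with ht
    have h2 : ‖Q - 1 - T‖ ≤ Real.exp t - 1 - t := norm_orderedProd_sub_one_sub_sum_le _
    have h3 : ‖Q - 1 - T - S₂‖ ≤ Real.exp t - 1 - t - t ^ 2 / 2 := ih _
    have e : (1 + A 0) * Q - 1 - (A 0 + T) - (A 0 * T + S₂) = (Q - 1 - T - S₂) + A 0 * (Q - 1 - T) := by noncomm_ring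
    rw [e]
    have hb : 0 ≤ ‖A 0‖ := norm_nonneg _
    have hq := Real.quadratic_le_exp_of_nonneg hb
    have ht1 : 1 ≤ Real.exp t := by
      have := Real.add_one_le_exp t
      have : 0 ≤ t := Finset.sum_nonneg fun i _ => norm_nonneg _
      linarith
    calc ‖(Q - 1 - T - S₂) + A 0 * (Q - 1 - T)‖ ≤ ‖Q - 1 - T - S₂‖ + ‖A 0‖ * ‖Q - 1 - T‖ :=
          (norm_add_le _ _).trans (add_le_add le_rfl (norm_mul_le _ _))
      _ ≤ (Real.exp t - 1 - t - t ^ 2 / 2) + ‖A 0‖ * (Real.exp t - 1 - t) := add_le_add h3 (mul_le_mul_of_nonneg_left h2 hb)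
      _ ≤ Real.exp (‖A 0‖ + t) - 1 - (‖A 0‖ + t) - (‖A 0‖ + t) ^ 2 / 2 := by
          rw [Real.exp_add]
          -- RHS − LHS = e^t(e^b − 1 − b) − b²/2 ≥ (e^b − 1 − b) − b²/2 ≥ 0
          have hk : 0 ≤ Real.exp ‖A 0‖ - 1 - ‖A 0‖ - ‖A 0‖ ^ 2 / 2 := by linarith [hq]
          have hm : (Real.exp ‖A 0‖ - 1 - ‖A 0‖) * 1 ≤ (Real.exp ‖A 0‖ - 1 - ‖A 0‖) * Real.exp t :=
            mul_le_mul_of_nonneg_left ht1 (by nlinarith [hq, sq_nonneg ‖A 0‖])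
          nlinarith [hk, hm]

/-! ## §3 The pair sum as half a square plus half the commutator sum -/

omit [NormOneClass R] in
/-- **`2·Σ_{i<j}A_iA_j = (ΣA_i)² − ΣA_i² + Σ_{i<j}(A_iA_j − A_jA_i)`** (ordered family in any ring; for `𝔰𝔲(2)`-valued `A_i` the two squares are scalar).
[cite: Balaban1985Averaging, (19)-(23) p.21] -/
theorem two_smul_pairSum_eq : ∀ {m : ℕ} (A : Fin m → R),
    (2 : ℕ) • (∑ i : Fin m, ∑ j : Fin m, if i < j then A i * A j else 0)
      = (∑ i, A i) * (∑ i, A i) - ∑ i, A i * A i + ∑ i : Fin m, ∑ j : Fin m, (if i < j then A i * A j - A j * A i else 0) := by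
  intro m
  induction m with
  | zero => intro A; simp
  | succ m ih =>
    intro A
    rw [pairSum_succ, commSum_succ, Fin.sum_univ_succ (f := fun i => A i * A i), Fin.sum_univ_succ (f := fun i => A i)]
    have hIH := ih (fun i => A i.succ)
    rw [smul_add, hIH]
    noncomm_ring

/-! ## §4 The commutator pair sum is charged by MASS × OSCILLATION along the word (p1 g13, 2026-08-28)

WHY (route-R lead g13; the JOINT remainder row of the growth-side door ✓`Prop7LocMinOfMultiplierRows` ∕ ★w4's ✓`Prop7LocMinOfJointRow.linRow_of_QRows`, and
★routeR-w6 g3's N3b FILE 2 source bound).  In the exp-mean-log currency the second-order source of the one-step (0.4) average along an exponential family at a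
flat word is HALF THE MEAN COMMUTATOR SUM `½·mean_w Σ_{i<j}[Ã_i, Ã_j]` of the transported bond fields along each word (the scalar squares of §3 never enter the
logarithm).  A word-COHERENT family (all `A_i` equal — the «abelian trunk» that defeats every per-bond-mass bound, ★routeR-w1 g2 ∕ ★routeR-w3 g3 located notes)
has commutator sum ZERO; in general `[A_i, A_j] = [A_i, A_j − A_i]`, so the commutator sum is charged by the `ℓ¹`-MASS `Σ_i‖A_i‖` times the `ℓ¹`-OSCILLATION
`Σ_s‖A_{s+1} − A_s‖` along the word (times the word length).  WHERE THIS IS THE MECHANISM AND WHERE IT IS NOT (honest): along a STRAIGHT averaging segment (letters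
of ONE direction) the oscillation is the longitudinal covariant difference, paid by the gradient energy (curl + divergence on the slice + curvature·mass,
[Balaban1985BackgroundPropagators] (3.43)) — after Cauchy–Schwarz and `ab ≤ (a²ℓ⁻¹ + b²ℓ)∕2` this is the `(mass, curl)` currency of the door's third row.  At the
stair CORNERS of the symmetric (0.4) words consecutive letters carry DIFFERENT directions (`‖A_μ − A_ν‖ ~ |A|`, not a gradient) and this lemma is NOT the mechanism:
writing a word as `F · S · (F′)⁻¹` (forward legs, straight segment, translated backward legs) one has
`C(w) = C(S) + (C(F) − C(F′)) − [ΣF, ΣF′ − ΣF] + [ΣF + ΣF′, ΣS]` (`C` = ordered commutator pair sum): the leg terms are DIFFERENCES between the leg and its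
`L·e_μ`-translate (mass × longitudinal gradient), and the leg–segment cross term is odd in the offset and cancels in the symmetric mean up to transverse gradients
(for a constant field the mean commutator sum vanishes exactly).  This §4 supplies the straight-segment piece `C(S)`. -/

omit [NormOneClass R] in
/-- Telescoping along the word: `‖A_j − A_0‖ ≤ Σ_{s<m}‖A_{s+1} − A_s‖` for every `j ≤ m`. [folklore] -/
theorem norm_sub_head_le_osc : ∀ {m : ℕ} (A : Fin (m + 1) → R) (j : Fin (m + 1)),
    ‖A j - A 0‖ ≤ ∑ s : Fin m, ‖A s.succ - A (Fin.castSucc s)‖ := by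
  intro m
  induction m with
  | zero =>
    intro A j
    rw [Fin.fin_one_eq_zero j, sub_self, norm_zero]
    exact Finset.sum_nonneg fun _ _ => norm_nonneg _
  | succ m ih =>
    intro A j
    rw [Fin.sum_univ_succ (f := fun s : Fin (m + 1) => ‖A s.succ - A (Fin.castSucc s)‖)]
    simp only [Fin.castSucc_zero]
    rcases Fin.eq_zero_or_eq_succ j with hj | ⟨j', rfl⟩
    · rw [hj, sub_self, norm_zero]
      exact add_nonneg (norm_nonneg _) (Finset.sum_nonneg fun _ _ => norm_nonneg _)
    · have hIH := ih (fun i => A i.succ) j'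
      have htri : ‖A j'.succ - A 0‖ ≤ ‖A j'.succ - A (Fin.succ 0)‖ + ‖A (Fin.succ 0) - A 0‖ := norm_sub_le_norm_sub_add_norm_sub _ _ _
      have hcast : ∀ s : Fin m, A (Fin.castSucc s).succ = A (Fin.castSucc s.succ) := fun s => by rw [Fin.succ_castSucc]
      simp only [hcast] at hIH
      linarith [hIH, htri]

omit [NormOneClass R] in
/-- ★ **THE COMMUTATOR PAIR SUM IS CHARGED BY MASS × OSCILLATION**: for an ordered family `A : Fin (m+1) → R` in any normed ring,
`‖Σ_{i<j}(A_iA_j − A_jA_i)‖ ≤ 2·m·(Σ_i‖A_i‖)·(Σ_{s<m}‖A_{s+1} − A_s‖)`.  In particular a word-coherent family (`A_i` constant along the word) contributes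
nothing, however large its mass — the mechanism behind the `(mass, curl)` currency of the joint remainder row. [cite: Balaban1985Averaging, (19)-(23) p.21; Balaban1985BackgroundPropagators, (3.43) p.398] -/
theorem norm_commSum_le_mass_mul_osc : ∀ {m : ℕ} (A : Fin (m + 1) → R),
    ‖∑ i : Fin (m + 1), ∑ j : Fin (m + 1), (if i < j then A i * A j - A j * A i else 0)‖
      ≤ 2 * (m : ℝ) * (∑ i : Fin (m + 1), ‖A i‖) * (∑ s : Fin m, ‖A s.succ - A (Fin.castSucc s)‖) := by
  intro m
  induction m with
  | zero =>
    intro A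
    have h0 : (∑ i : Fin (0 + 1), ∑ j : Fin (0 + 1), (if i < j then A i * A j - A j * A i else 0)) = 0 := by
      simp
    rw [h0, norm_zero]
    simp
  | succ m ih =>
    intro A
    rw [commSum_succ]
    -- letters: head `A 0`, tail `B = A ∘ succ`, mass, oscillation
    set B : Fin (m + 1) → R := fun i => A i.succ with hB
    set Osc : ℝ := ∑ s : Fin (m + 1), ‖A s.succ - A (Fin.castSucc s)‖ with hOsc
    set OscB : ℝ := ∑ s : Fin m, ‖B s.succ - B (Fin.castSucc s)‖ with hOscB
    set MassB : ℝ := ∑ i : Fin (m + 1), ‖B i‖ with hMassB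
    have hOsc0 : 0 ≤ Osc := Finset.sum_nonneg fun _ _ => norm_nonneg _
    have hOscB0 : 0 ≤ OscB := Finset.sum_nonneg fun _ _ => norm_nonneg _
    have hMassB0 : 0 ≤ MassB := Finset.sum_nonneg fun _ _ => norm_nonneg _
    have hA0 : 0 ≤ ‖A 0‖ := norm_nonneg _
    -- the oscillation of the tail is at most the oscillation of the word, and `Osc = ‖A 1 − A 0‖ + OscB`
    have hOsc_split : Osc = ‖A (Fin.succ 0) - A 0‖ + OscB := by
      rw [hOsc, Fin.sum_univ_succ]
      simp only [Fin.castSucc_zero, hOscB, hB, Fin.succ_castSucc]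
    have hOscB_le : OscB ≤ Osc := by rw [hOsc_split]; linarith [norm_nonneg (A (Fin.succ 0) - A 0)]
    -- mass splits
    have hMass : (∑ i : Fin (m + 2), ‖A i‖) = ‖A 0‖ + MassB := by rw [Fin.sum_univ_succ]
    -- (a) the head term: `A₀T − TA₀ = Σ_i (A₀(B_i − A₀) − (B_i − A₀)A₀)`
    have hhead_eq : A 0 * (∑ i : Fin (m + 1), A i.succ) - (∑ i : Fin (m + 1), A i.succ) * A 0
        = ∑ i : Fin (m + 1), (A 0 * (B i - A 0) - (B i - A 0) * A 0) := by
      rw [Finset.mul_sum, Finset.sum_mul, ← Finset.sum_sub_distrib]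
      refine Finset.sum_congr rfl fun i _ => ?_
      simp only [hB]; noncomm_ring
    have hBi : ∀ i : Fin (m + 1), ‖B i - A 0‖ ≤ Osc := fun i => by
      have := norm_sub_head_le_osc A i.succ
      simpa [hB, hOsc] using this
    have hhead : ‖A 0 * (∑ i : Fin (m + 1), A i.succ) - (∑ i : Fin (m + 1), A i.succ) * A 0‖ ≤ 2 * ((m : ℝ) + 1) * ‖A 0‖ * Osc := by
      rw [hhead_eq]
      calc ‖∑ i : Fin (m + 1), (A 0 * (B i - A 0) - (B i - A 0) * A 0)‖
          ≤ ∑ i : Fin (m + 1), ‖A 0 * (B i - A 0) - (B i - A 0) * A 0‖ := norm_sum_le _ _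
        _ ≤ ∑ _i : Fin (m + 1), 2 * ‖A 0‖ * Osc := by
            refine Finset.sum_le_sum fun i _ => ?_
            calc ‖A 0 * (B i - A 0) - (B i - A 0) * A 0‖ ≤ ‖A 0 * (B i - A 0)‖ + ‖(B i - A 0) * A 0‖ := norm_sub_le _ _
              _ ≤ ‖A 0‖ * ‖B i - A 0‖ + ‖B i - A 0‖ * ‖A 0‖ := add_le_add (norm_mul_le _ _) (norm_mul_le _ _)
              _ ≤ ‖A 0‖ * Osc + Osc * ‖A 0‖ := add_le_add (mul_le_mul_of_nonneg_left (hBi i) hA0) (mul_le_mul_of_nonneg_right (hBi i) hA0)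
              _ = 2 * ‖A 0‖ * Osc := by ring
        _ = 2 * ((m : ℝ) + 1) * ‖A 0‖ * Osc := by
            rw [Finset.sum_const, Finset.card_univ, Fintype.card_fin, nsmul_eq_mul]; push_cast; ring
    -- (b) the tail by induction
    have htail : ‖∑ i : Fin (m + 1), ∑ j : Fin (m + 1), (if i < j then A i.succ * A j.succ - A j.succ * A i.succ else 0)‖
        ≤ 2 * (m : ℝ) * MassB * OscB := ih B
    -- assemble
    calc ‖A 0 * (∑ i : Fin (m + 1), A i.succ) - (∑ i : Fin (m + 1), A i.succ) * A 0
            + ∑ i : Fin (m + 1), ∑ j : Fin (m + 1), (if i < j then A i.succ * A j.succ - A j.succ * A i.succ else 0)‖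
        ≤ 2 * ((m : ℝ) + 1) * ‖A 0‖ * Osc + 2 * (m : ℝ) * MassB * OscB := (norm_add_le _ _).trans (add_le_add hhead htail)
      _ ≤ 2 * ((m : ℝ) + 1) * ‖A 0‖ * Osc + 2 * ((m : ℝ) + 1) * MassB * Osc := by
            have h1 : 2 * (m : ℝ) * MassB * OscB ≤ 2 * (m : ℝ) * MassB * Osc :=
              mul_le_mul_of_nonneg_left hOscB_le (by positivity)
            have h2 : 2 * (m : ℝ) * MassB * Osc ≤ 2 * ((m : ℝ) + 1) * MassB * Osc := by nlinarith [mul_nonneg hMassB0 hOsc0]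
            linarith
      _ = 2 * ((m + 1 : ℕ) : ℝ) * (∑ i : Fin (m + 2), ‖A i‖) * Osc := by rw [hMass]; push_cast; ring

/-! ## §5 Word algebra for the three-piece identity: concatenation and reversal of the ordered commutator pair sum (p1 g13, 2026-08-28)

WHY.  A symmetric (0.4) averaging word is `F · S · (F′)⁻¹` (forward stair legs, straight segment, translated backward legs traversed in reverse with inverted
letters).  With `C(·)` the ordered commutator pair sum and `Σ·` the letter sum, the two identities below give
`C(F ⧺ S ⧺ rev(−F′)) = C(S) + (C(F) − C(F′)) − [ΣF, ΣF′ − ΣF] + [ΣF + ΣF′, ΣS]` (expand twice, `C(rev(−F′)) = −C(F′)`, `Σ rev(−F′) = −ΣF′`):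
the straight piece `C(S)` is §4's mass × longitudinal oscillation, the leg pieces are DIFFERENCES between the legs and their translate, and the leg–segment cross term is
odd in the stair offset (cancels in the symmetric mean up to transverse differences) — the honest mechanism of the `(mass, gradient)` source bound at the stair corners,
where consecutive letters change direction and §4 alone would charge mass × mass. -/

omit [NormOneClass R] in
/-- **Concatenation**: `C(u ⧺ v) = C(u) + C(v) + ((Σu)(Σv) − (Σv)(Σu))` for the ordered commutator pair sum of `Fin.append u v`. [folklore] -/
theorem commSum_append {m n : ℕ} (u : Fin m → R) (v : Fin n → R) :
    (∑ i : Fin (m + n), ∑ j : Fin (m + n), (if i < j then Fin.append u v i * Fin.append u v j - Fin.append u v j * Fin.append u v i else 0))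
      = (∑ i : Fin m, ∑ j : Fin m, (if i < j then u i * u j - u j * u i else 0))
        + (∑ i : Fin n, ∑ j : Fin n, (if i < j then v i * v j - v j * v i else 0))
        + ((∑ i : Fin m, u i) * (∑ j : Fin n, v j) - (∑ j : Fin n, v j) * (∑ i : Fin m, u i)) := by
  rw [Fin.sum_univ_add]
  simp_rw [Fin.sum_univ_add, Fin.append_left, Fin.append_right]
  have hll : ∀ i j : Fin m, (Fin.castAdd n i < Fin.castAdd n j) = (i < j) := fun i j => by
    simp only [Fin.lt_def, Fin.val_castAdd]
  have hlr : ∀ (i : Fin m) (j : Fin n), Fin.castAdd n i < Fin.natAdd m j := fun i j => by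
    rw [Fin.lt_def, Fin.val_castAdd, Fin.val_natAdd]; omega
  have hrl : ∀ (i : Fin n) (j : Fin m), ¬ Fin.natAdd m i < Fin.castAdd n j := fun i j => by
    rw [Fin.lt_def, Fin.val_castAdd, Fin.val_natAdd]; omega
  have hrr : ∀ i j : Fin n, (Fin.natAdd m i < Fin.natAdd m j) = (i < j) := fun i j => by
    simp only [Fin.lt_def, Fin.val_natAdd]; exact propext ⟨fun h => by omega, fun h => by omega⟩
  simp only [hll, hrr, if_pos (hlr _ _), if_neg (hrl _ _), Finset.sum_const_zero, zero_add, Finset.sum_add_distrib]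
  rw [Finset.sum_mul_sum, Finset.sum_mul_sum, Finset.sum_comm (s := (Finset.univ : Finset (Fin n))) (t := (Finset.univ : Finset (Fin m))),
    ← Finset.sum_sub_distrib]
  simp_rw [← Finset.sum_sub_distrib]
  abel

omit [NormOneClass R] in
/-- **Reversal with inverted letters**: `C(rev(−u)) = −C(u)` — traversing a leg backwards with inverse (to first order: negated) letters flips the sign of its
ordered commutator pair sum. [folklore] -/
theorem commSum_rev_neg {m : ℕ} (u : Fin m → R) :
    (∑ i : Fin m, ∑ j : Fin m, (if i < j then (-u (Fin.rev i)) * (-u (Fin.rev j)) - (-u (Fin.rev j)) * (-u (Fin.rev i)) else 0))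
      = -(∑ i : Fin m, ∑ j : Fin m, (if i < j then u i * u j - u j * u i else 0)) := by
  simp only [neg_mul_neg]
  -- reindex both sums by the involution `Fin.rev`
  have h1 : (∑ i : Fin m, ∑ j : Fin m, (if i < j then u (Fin.rev i) * u (Fin.rev j) - u (Fin.rev j) * u (Fin.rev i) else 0))
      = ∑ a : Fin m, ∑ b : Fin m, (if b < a then u a * u b - u b * u a else 0) := by
    rw [← Equiv.sum_comp Fin.revPerm (fun i => ∑ j : Fin m, (if i < j then u (Fin.rev i) * u (Fin.rev j) - u (Fin.rev j) * u (Fin.rev i) else 0))]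
    refine Finset.sum_congr rfl fun a _ => ?_
    rw [← Equiv.sum_comp Fin.revPerm (fun j => (if Fin.revPerm a < j then u (Fin.rev (Fin.revPerm a)) * u (Fin.rev j) - u (Fin.rev j) * u (Fin.rev (Fin.revPerm a)) else 0))]
    refine Finset.sum_congr rfl fun b _ => ?_
    simp only [Fin.revPerm_apply, Fin.rev_rev, Fin.rev_lt_rev]
  rw [h1, Finset.sum_comm, ← Finset.sum_neg_distrib]
  refine Finset.sum_congr rfl fun i _ => ?_
  rw [← Finset.sum_neg_distrib]
  refine Finset.sum_congr rfl fun j _ => ?_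
  by_cases h : i < j
  · rw [if_pos h, if_pos h, neg_sub]
  · rw [if_neg h, if_neg h, neg_zero]

end Summit.QuantumFields.YangMills.Theorems.Prop7OrderedProductExpansion

end
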